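import Summits.AtomisticToContinuum.Crystallization.Theorems.ExcessDecayLiouvillePhononStabilityCertCell
import Summits.AtomisticToContinuum.Crystallization.Theorems.ExcessDecayLiouvillePhononStabilityCertNode
import Summits.AtomisticToContinuum.Crystallization.Theorems.ExcessDecayLiouvillePhononStabilityCertCover

/-!
# Near-certificate layer V6-c (part 1, cells and prune certificates): the dyadic grid of the vertex scheme and its soundness (lead c2)

Support file for crux `PhononStability` (stmt-AtomisticToContinuum-9333), line `contragredient-window-collapse`.

Cells of the chart box are rational boxes (centre, half-widths).  A `GTree` cuts cells along single axes at
rational points down to leaves of four kinds: CHECK (the model form is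
certified on the cell by the cell theorem from the node statements at its `2⁹` vertices), PRUNE-HI / PRUNE-LO
(a rational direction `y` along which the pulled-back metric leaves the spectral band on the whole cell, so no
window datum is charted there), PRUNE-SHIFT (the shift ellipsoid misses the cell) and OUT-F (the cell misses the
fundamental domain `x₁ ≤ x₂ ≤ x₃`).  `treeOK` checks the leaf certificates; `treeNodes` lists the node keys (vertex,
half-widths) the CHECK leaves need.  `tree_sound`: global shape and positivity checks, the node statements for
`treeNodes`, and `treeOK` give `Fmodel ≥ 0` on (cell ∩ domain).  Node keys are deduplicated by `sortDedup`
(membership preserved, `mem_sortDedup`) and proved in chunks (`all_of_chunks`).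
-/

noncomputable section

open scoped BigOperators
open Set Function
open Summit.AtomisticToContinuum.Crystallization.Theorems.PhononStabilityNegative

namespace Summit.AtomisticToContinuum.Crystallization.Theorems.PhononStabilityCWC.Cert

local notation "E3" => EuclideanSpace ℝ (Fin 3)

/-! ## Cells -/

/-- a rational cell: centre and half-widths -/
structure DCell where
  /-- centre -/
  cq : Fin 9 → ℚ
  /-- half-widths -/
  hq : Fin 9 → ℚ

namespace DCell

/-- the low child of the cut of axis `v` at the point `t` (meant to lie strictly inside): `[c − h, t]` -/
def childLo (c : DCell) (v : Fin 9) (t : ℚ) : DCell :=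
  ⟨update c.cq v ((c.cq v - c.hq v + t) / 2), update c.hq v ((t - (c.cq v - c.hq v)) / 2)⟩
/-- the high child: `[t, c + h]` -/
def childHi (c : DCell) (v : Fin 9) (t : ℚ) : DCell :=
  ⟨update c.cq v ((t + (c.cq v + c.hq v)) / 2), update c.hq v (((c.cq v + c.hq v) - t) / 2)⟩
/-- the root cell of half-widths `hb` -/
def root (hb : Fin 9 → ℚ) : DCell := ⟨fun _ => 0, hb⟩

/-- the real box of a cell -/
def rbox (c : DCell) : Set (Fin 9 → ℝ) := box (fun i => (c.cq i : ℝ)) (fun i => (c.hq i : ℝ))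

/-- **the children cover the cell.** [folklore] -/
theorem mem_child_of_mem (c : DCell) (v : Fin 9) (t : ℚ) {x : Fin 9 → ℝ} (hx : x ∈ c.rbox) :
    x ∈ (c.childLo v t).rbox ∨ x ∈ (c.childHi v t).rbox := by
  unfold rbox box at *
  simp only [Set.mem_setOf_eq] at *
  by_cases hv : x v ≤ (t : ℝ)
  · left
    intro i
    unfold childLo
    by_cases hi : i = v
    · subst hi; simp only [update_self]; push_cast; have := hx i; constructor <;> linarith [this.1, this.2]
    · simp only [update_of_ne hi]; exact hx i
  · right
    intro i
    unfold childHi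
    by_cases hi : i = v
    · subst hi; simp only [update_self]; push_cast; have := hx i; push Not at hv; constructor <;> linarith [this.1, this.2]
    · simp only [update_of_ne hi]; exact hx i

end DCell

/-! ## The domain: fundamental domain and window image -/

/-- the affine metric entry `Ĝ_ij(x) = G_c,ij + X_ij(x)` of the root chart -/
def Ghat (x : Fin 9 → ℝ) (i j : Fin 3) : ℝ := (rootCell.G i j : ℝ) + spEval (XP i j) (toN x)

/-- the window image constraints a charted window datum satisfies: spectral band along every RATIONAL direction and
the shift ellipsoid -/
def DomK (x : Fin 9 → ℝ) : Prop :=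
  (∀ y : Fin 3 → ℚ, (189 / 200 : ℝ) ^ 2 * (∑ i, ∑ j, (y i : ℝ) * (M0Q i j : ℝ) * y j) ≤ ∑ i, ∑ j, (y i : ℝ) * Ghat x i j * y j
      ∧ ∑ i, ∑ j, (y i : ℝ) * Ghat x i j * y j ≤ (199 / 200 : ℝ) ^ 2 * (∑ i, ∑ j, (y i : ℝ) * (M0Q i j : ℝ) * y j))
  ∧ (189 / 200 : ℝ) ^ 2 * (∑ i : Fin 3, ∑ j : Fin 3, x ⟨6 + i.val, by omega⟩ * (M0Q i j : ℝ) * x ⟨6 + j.val, by omega⟩)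
      ≤ 1 / 1600

/-- the fundamental domain `x₁ ≤ x₂ ≤ x₃` (indices `0, 1, 2`) -/
def DomF (x : Fin 9 → ℝ) : Prop := x 0 ≤ x 1 ∧ x 1 ≤ x 2

/-! ## Affine functions over a cell -/

/-- the coefficient of the variable `v` in a (linear, single-variable-monomial) sparse polynomial -/
def linCoeff (p : SPoly) (v : ℕ) : ℚ := (p.map fun e => if e.1 = [v] then e.2 else 0).sum

/-- all monomials are single variables among `1 … 9` -/
def isLin9 (p : SPoly) : Bool := p.all fun e => decide (e.1.length = 1 ∧ 1 ≤ e.1.headD 0 ∧ e.1.headD 0 ≤ 9)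

/-- a linear polynomial evaluates to `Σ_v coef_v x_v`. [folklore] -/
theorem spEval_of_isLin9 {p : SPoly} (hp : isLin9 p = true) (x : Fin 9 → ℝ) :
    spEval p (toN x) = ∑ i : Fin 9, (linCoeff p (i.val + 1) : ℝ) * x i := by
  induction p with
  | nil => simp [linCoeff]
  | cons e p ih =>
      have hp' : isLin9 p = true := by simp only [isLin9, List.all_cons, Bool.and_eq_true] at hp ⊢; exact hp.2
      have he : e.1.length = 1 ∧ 1 ≤ e.1.headD 0 ∧ e.1.headD 0 ≤ 9 := by
        simp only [isLin9, List.all_cons, Bool.and_eq_true, decide_eq_true_eq] at hp; exact hp.1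
      obtain ⟨hlen, hv1, hv9⟩ := he
      obtain ⟨v, hev⟩ := List.length_eq_one_iff.mp hlen
      rw [hev] at hv1 hv9
      simp only [List.headD_cons] at hv1 hv9
      rw [spEval_cons, ih hp']
      have hlin : ∀ w, linCoeff (e :: p) w = (if e.1 = [w] then e.2 else 0) + linCoeff p w := by
        intro w; simp [linCoeff]
      have hm : monoVal (toN x) e.1 = x ⟨v - 1, by omega⟩ := by
        rw [hev]; simp [monoVal, toN, hv1, hv9]
      have hfirst : monoVal (toN x) e.1 * (e.2 : ℝ) = ∑ i : Fin 9, ((if e.1 = [i.val + 1] then e.2 else 0 : ℚ) : ℝ) * x i := by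
        rw [hm, Finset.sum_eq_single ⟨v - 1, by omega⟩]
        · have : e.1 = [(⟨v - 1, by omega⟩ : Fin 9).val + 1] := by rw [hev]; simp; omega
          simp only [this, ↓reduceIte]; ring
        · intro i _ hi
          have : e.1 ≠ [i.val + 1] := by
            rw [hev]; intro h
            apply hi
            have := (List.cons.inj h).1
            ext; simp; omega
          simp [this]
        · intro h; exact absurd (Finset.mem_univ _) h
      rw [hfirst, ← Finset.sum_add_distrib]
      refine Finset.sum_congr rfl fun i _ => ?_
      rw [hlin]; push_cast; ring

/-- minimum of an affine function `a + Σ coef_i x_i` over a cell -/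
def affMin (a : ℚ) (coef cq hq : Fin 9 → ℚ) : ℚ := a + ∑ i, (coef i * cq i - |coef i| * hq i)

/-- **the affine minimum bound.** [folklore] -/
theorem affMin_le (a : ℚ) (coef cq hq : Fin 9 → ℚ) {x : Fin 9 → ℝ}
    (hx : x ∈ box (fun i => (cq i : ℝ)) (fun i => (hq i : ℝ))) :
    (affMin a coef cq hq : ℝ) ≤ (a : ℝ) + ∑ i, (coef i : ℝ) * x i := by
  have key : ∀ i, ((coef i * cq i - |coef i| * hq i : ℚ) : ℝ) ≤ (coef i : ℝ) * x i := by
    intro i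
    have ⟨h1, h2⟩ := hx i
    have hxc : |x i - cq i| ≤ hq i := by rw [abs_le]; constructor <;> linarith
    have h3 : |(coef i : ℝ) * (x i - cq i)| ≤ |(coef i : ℝ)| * hq i := by
      rw [abs_mul]; exact mul_le_mul_of_nonneg_left hxc (abs_nonneg _)
    have h4 := neg_abs_le ((coef i : ℝ) * (x i - cq i))
    push_cast
    nlinarith
  have hs := Finset.sum_le_sum fun i (_ : i ∈ Finset.univ) => key i
  push_cast at hs
  unfold affMin; push_cast
  linarith

/-! ## Prune certificates -/

/-- the quadratic `yᵀ M y` for rational `y` and matrix `M` -/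
def quadQ (M : Mat) (y : Fin 3 → ℚ) : ℚ := ∑ i, ∑ j, y i * M i j * y j

/-- the linear coefficients of `x ↦ yᵀ X(x) y` -/
def bandCoef (y : Fin 3 → ℚ) : Fin 9 → ℚ := fun v => ∑ i, ∑ j, y i * linCoeff (XP i j) (v.val + 1) * y j

/-- all `XP` are linear in the variables `1 … 9` -/
def xpLinOK : Bool := decide (∀ i j : Fin 3, isLin9 (XP i j) = true)

/-- `yᵀ Ĝ(x) y = yᵀ G_c y + Σ_v bandCoef_v x_v`. [folklore] -/
theorem quad_Ghat_eq (hxp : xpLinOK = true) (y : Fin 3 → ℚ) (x : Fin 9 → ℝ) :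
    ∑ i, ∑ j, (y i : ℝ) * Ghat x i j * y j = (quadQ rootCell.G y : ℝ) + ∑ v, (bandCoef y v : ℝ) * x v := by
  unfold xpLinOK at hxp; simp only [decide_eq_true_eq] at hxp
  have h1 : ∀ i j, (y i : ℝ) * Ghat x i j * y j
      = (y i : ℝ) * rootCell.G i j * y j + ∑ v : Fin 9, ((y i : ℝ) * linCoeff (XP i j) (v.val + 1) * y j) * x v := by
    intro i j
    unfold Ghat
    rw [spEval_of_isLin9 (hxp i j), mul_add, add_mul, Finset.mul_sum, Finset.sum_mul]
    congr 1
    refine Finset.sum_congr rfl fun v _ => ?_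
    ring
  simp_rw [h1, Finset.sum_add_distrib]
  congr 1
  · unfold quadQ; push_cast; rfl
  · -- bring the `v`-sum outside and factor `x_v`
    calc ∑ i : Fin 3, ∑ j : Fin 3, ∑ v : Fin 9, ((y i : ℝ) * linCoeff (XP i j) (v.val + 1) * y j) * x v
        = ∑ i : Fin 3, ∑ v : Fin 9, ∑ j : Fin 3, ((y i : ℝ) * linCoeff (XP i j) (v.val + 1) * y j) * x v :=
          Finset.sum_congr rfl fun i _ => Finset.sum_comm
      _ = ∑ v : Fin 9, ∑ i : Fin 3, ∑ j : Fin 3, ((y i : ℝ) * linCoeff (XP i j) (v.val + 1) * y j) * x v := Finset.sum_comm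
      _ = ∑ v : Fin 9, (bandCoef y v : ℝ) * x v := Finset.sum_congr rfl fun v _ => by
          unfold bandCoef; push_cast
          rw [Finset.sum_mul]
          refine Finset.sum_congr rfl fun i _ => ?_
          rw [Finset.sum_mul]

/-- PRUNE-HI certificate: along `y` the metric exceeds the upper band on the whole cell -/
def pruneHiOK (y : Fin 3 → ℚ) (cq hq : Fin 9 → ℚ) : Bool :=
  decide ((199 / 200 : ℚ) ^ 2 * quadQ M0Q y < affMin (quadQ rootCell.G y) (bandCoef y) cq hq)

/-- PRUNE-LO certificate: along `y` the metric is below the lower band on the whole cell -/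
def pruneLoOK (y : Fin 3 → ℚ) (cq hq : Fin 9 → ℚ) : Bool :=
  decide (-((189 / 200 : ℚ) ^ 2 * quadQ M0Q y) < affMin (-quadQ rootCell.G y) (fun v => -bandCoef y v) cq hq)

/-- the tangent-plane lower bound of the shift quadratic at the cell centre -/
def shiftTangent (cq : Fin 9 → ℚ) : ℚ × (Fin 9 → ℚ) :=
  let d0 : Fin 3 → ℚ := fun i => cq ⟨6 + i.val, by omega⟩
  let g : Fin 3 → ℚ := fun i => ∑ j, (M0Q i j + M0Q j i) * d0 j
  (quadQ M0Q d0 - ∑ i, g i * d0 i, fun v => if h : 6 ≤ v.val then g ⟨v.val - 6, by omega⟩ else 0)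

/-- PRUNE-SHIFT certificate: the shift ellipsoid misses the whole cell -/
def pruneShiftOK (cq hq : Fin 9 → ℚ) : Bool :=
  decide (1 / 1600 < (189 / 200 : ℚ) ^ 2 * affMin (shiftTangent cq).1 (shiftTangent cq).2 cq hq)

/-- OUT-F certificate: the cell misses `x₁ ≤ x₂ ≤ x₃` (`j = 0`: `x₁ > x₂` on the cell; `j = 1`: `x₂ > x₃`) -/
def outFOK (j : Fin 2) (cq hq : Fin 9 → ℚ) : Bool :=
  if j = 0 then decide (cq 1 + hq 1 < cq 0 - hq 0) else decide (cq 2 + hq 2 < cq 1 - hq 1)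

/-- `M₀` is positive semidefinite (as a rational quadratic form, over the reals). [folklore] -/
theorem quad_M0Q_psd (d : Fin 3 → ℝ) : 0 ≤ ∑ i, ∑ j, d i * (M0Q i j : ℝ) * d j := by
  have : ∑ i, ∑ j, d i * (M0Q i j : ℝ) * d j = (d 0 + d 1 / 2) ^ 2 + 3 / 4 * d 1 ^ 2 + 8 / 3 * d 2 ^ 2 := by
    simp only [Fin.sum_univ_three, M0Q]; push_cast; ring
  rw [this]; positivity

/-- convexity of the shift quadratic: it lies above its tangent plane at the cell centre. [folklore] -/
theorem shift_ge_tangent (cq : Fin 9 → ℚ) (x : Fin 9 → ℝ) :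
    ((shiftTangent cq).1 : ℝ) + ∑ v, ((shiftTangent cq).2 v : ℝ) * x v
      ≤ ∑ i : Fin 3, ∑ j : Fin 3, x ⟨6 + i.val, by omega⟩ * (M0Q i j : ℝ) * x ⟨6 + j.val, by omega⟩ := by
  -- `q(x) − q(d0) − ∇q(d0)·(x − d0) = q(x − d0) ≥ 0`
  set d0 : Fin 3 → ℝ := fun i => (cq ⟨6 + i.val, by omega⟩ : ℝ)
  set xs : Fin 3 → ℝ := fun i => x ⟨6 + i.val, by omega⟩
  have hpsd := quad_M0Q_psd (fun i => xs i - d0 i)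
  have hsum : ∑ v : Fin 9, ((shiftTangent cq).2 v : ℝ) * x v
      = ∑ i : Fin 3, (∑ j : Fin 3, ((M0Q i j : ℝ) + M0Q j i) * d0 j) * xs i := by
    unfold shiftTangent
    simp only [Fin.sum_univ_succ, Fin.sum_univ_zero]
    simp [d0, xs]
  have h1 : ((shiftTangent cq).1 : ℝ) = (∑ i, ∑ j, d0 i * (M0Q i j : ℝ) * d0 j)
      - ∑ i, (∑ j, ((M0Q i j : ℝ) + M0Q j i) * d0 j) * d0 i := by
    unfold shiftTangent quadQ; push_cast; simp [d0]
  rw [hsum, h1]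
  simp only [Fin.sum_univ_three] at hpsd ⊢
  simp only [M0Q] at hpsd ⊢
  push_cast at hpsd ⊢
  nlinarith [hpsd]

/-- soundness of PRUNE-HI: no point of the cell is in the window image. [folklore] -/
theorem pruneHi_sound (hxp : xpLinOK = true) {y : Fin 3 → ℚ} {cq hq : Fin 9 → ℚ} (h : pruneHiOK y cq hq = true)
    {x : Fin 9 → ℝ} (hx : x ∈ box (fun i => (cq i : ℝ)) (fun i => (hq i : ℝ))) : ¬ DomK x := by
  intro hD
  have hb := (hD.1 y).2
  rw [quad_Ghat_eq hxp] at hb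
  have hmin := affMin_le (quadQ rootCell.G y) (bandCoef y) cq hq hx
  unfold pruneHiOK at h; simp only [decide_eq_true_eq] at h
  have h' : (((199 / 200 : ℚ) ^ 2 * quadQ M0Q y : ℚ) : ℝ) < (affMin (quadQ rootCell.G y) (bandCoef y) cq hq : ℝ) := by
    exact_mod_cast h
  have hq' : (((199 / 200 : ℚ) ^ 2 * quadQ M0Q y : ℚ) : ℝ) = (199 / 200 : ℝ) ^ 2 * ∑ i, ∑ j, (y i : ℝ) * (M0Q i j : ℝ) * y j := by
    unfold quadQ; push_cast; rfl
  linarith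

/-- soundness of PRUNE-LO. [folklore] -/
theorem pruneLo_sound (hxp : xpLinOK = true) {y : Fin 3 → ℚ} {cq hq : Fin 9 → ℚ} (h : pruneLoOK y cq hq = true)
    {x : Fin 9 → ℝ} (hx : x ∈ box (fun i => (cq i : ℝ)) (fun i => (hq i : ℝ))) : ¬ DomK x := by
  intro hD
  have hb := (hD.1 y).1
  rw [quad_Ghat_eq hxp] at hb
  have hmin := affMin_le (-quadQ rootCell.G y) (fun v => -bandCoef y v) cq hq hx
  have e1 : ((-quadQ rootCell.G y : ℚ) : ℝ) + ∑ i, (((fun v => -bandCoef y v) i : ℚ) : ℝ) * x i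
      = -((quadQ rootCell.G y : ℝ) + ∑ v, (bandCoef y v : ℝ) * x v) := by
    push_cast
    rw [neg_add, ← Finset.sum_neg_distrib]
    congr 1
    exact Finset.sum_congr rfl fun i _ => by ring
  rw [e1] at hmin
  unfold pruneLoOK at h; simp only [decide_eq_true_eq] at h
  have h' : ((-((189 / 200 : ℚ) ^ 2 * quadQ M0Q y) : ℚ) : ℝ)
      < (affMin (-quadQ rootCell.G y) (fun v => -bandCoef y v) cq hq : ℝ) := by exact_mod_cast h
  have hq' : ((-((189 / 200 : ℚ) ^ 2 * quadQ M0Q y) : ℚ) : ℝ) = -((189 / 200 : ℝ) ^ 2 * ∑ i, ∑ j, (y i : ℝ) * (M0Q i j : ℝ) * y j) := by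
    unfold quadQ; push_cast; rfl
  linarith

/-- soundness of PRUNE-SHIFT. [folklore] -/
theorem pruneShift_sound {cq hq : Fin 9 → ℚ} (h : pruneShiftOK cq hq = true)
    {x : Fin 9 → ℝ} (hx : x ∈ box (fun i => (cq i : ℝ)) (fun i => (hq i : ℝ))) : ¬ DomK x := by
  intro hD
  have hs := hD.2
  have hmin := affMin_le (shiftTangent cq).1 (shiftTangent cq).2 cq hq hx
  have htan := shift_ge_tangent cq x
  unfold pruneShiftOK at h; simp only [decide_eq_true_eq] at h
  have h' : ((1 / 1600 : ℚ) : ℝ) < (((189 / 200 : ℚ) ^ 2 * affMin (shiftTangent cq).1 (shiftTangent cq).2 cq hq : ℚ) : ℝ) := by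
    exact_mod_cast h
  push_cast at h'
  nlinarith

/-- soundness of OUT-F. [folklore] -/
theorem outF_sound {j : Fin 2} {cq hq : Fin 9 → ℚ} (h : outFOK j cq hq = true)
    {x : Fin 9 → ℝ} (hx : x ∈ box (fun i => (cq i : ℝ)) (fun i => (hq i : ℝ))) : ¬ DomF x := by
  intro hF
  unfold outFOK at h
  have h0 := hx 0; have h1 := hx 1; have h2 := hx 2
  simp only at h0 h1 h2
  fin_cases j
  · simp only [Fin.zero_eta, Fin.isValue, ↓reduceIte, decide_eq_true_eq] at h
    have : ((cq 1 + hq 1 : ℚ) : ℝ) < ((cq 0 - hq 0 : ℚ) : ℝ) := by exact_mod_cast h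
    push_cast at this
    linarith [hF.1, h0.1, h1.2]
  · simp only [Fin.mk_one, Fin.isValue, one_ne_zero, ↓reduceIte, decide_eq_true_eq] at h
    have : ((cq 2 + hq 2 : ℚ) : ℝ) < ((cq 1 - hq 1 : ℚ) : ℝ) := by exact_mod_cast h
    push_cast at this
    linarith [hF.2, h1.1, h2.2]

/-- Anchor of this support file (registered stub of the line skeleton, lead c2): the root cell of unit half-widths. -/
theorem stub_certGridA : (DCell.root fun _ => (1 : ℚ)).hq 0 = 1 := by
  rfl

end Summit.AtomisticToContinuum.Crystallization.Theorems.PhononStabilityCWC.Cert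

end
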